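import Literature.AlgebraicGeometry.Smoothening.SmoothSpecialFibre
import Mathlib.RingTheory.RingHom.Smooth
import Mathlib.RingTheory.Smooth.Local
import HarnessLib

/-!
# The residue fields at the generic points of the special fibre of a smooth scheme are
# separable over the residue field of the base

Topic: `Literature/AlgebraicGeometry/Smoothening` (Bosch–Lütkebohmert–Raynaud, *Néron Models*,
§2.2–2.3 and §3.6: the local rings of a smooth `R`-scheme at the generic points of its special
fibre are discrete valuation rings "of ramification index `1`" over `R` — uniformizer `ϖ`
(`SmoothSpecialFibre`) *and* residue field separable over `k = R/(ϖ)`; these are the test rings of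
the smoothening process and of the Néron mapping property for a general, possibly imperfect,
residue field). Ring form: `A` a smooth `R`-algebra, `P` a minimal prime of `ϖA`; then
`R → A_P` is a local homomorphism (`isLocalHom_algebraMap_localization`) and the induced map of
residue fields `k → κ(P)` is formally smooth, i.e. `κ(P)/k` is separable
(`formallySmooth_residueFieldMap`): `κ(P) = A_P/ϖA_P` (the maximal ideal of `A_P` is `(ϖ)`,
`maximalIdeal_localization_eq_span`) is the base change `k ⊗_R A_P` of the formally smooth
`R`-algebra `A_P` (Mathlib `Algebra.TensorProduct.quotIdealMapEquivQuotTensor`).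
[folklore]; no named facts (D-0026).

## References

* S. Bosch, W. Lütkebohmert, M. Raynaud, *Néron Models*, Springer 1990, §2.3, §3.6.
  [BLRNeronModels1990] (Not held; section numbers only.)
* M. Artin, *Néron Models*, in Cornell–Silverman (eds.), *Arithmetic Geometry*, Springer 1986,
  (3.1) "smooth prime divisors" (p. 223). [Artin1986NeronModels]
-/

noncomputable section

open scoped TensorProduct
open IsLocalRing

namespace Literature.AlgebraicGeometry.Smoothening

universe u

variable {R : Type u} [CommRing R] [IsDomain R] [IsDiscreteValuationRing R] {ϖ : R} (hϖ : Irreducible ϖ)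
  {A : Type u} [CommRing A] [Algebra R A] [Algebra.Smooth R A]
  (P : Ideal A) [P.IsPrime] (hP : P ∈ (Ideal.span {algebraMap R A ϖ}).minimalPrimes)

include hP in
omit [IsDomain R] [IsDiscreteValuationRing R] [Algebra.Smooth R A] in
/-- `R → A_P` is a local homomorphism for a prime `P ∋ ϖ` (here: a minimal prime of `ϖA`).
[folklore] -/
theorem isLocalHom_algebraMap_localization [IsLocalRing R] (hmax : maximalIdeal R = Ideal.span {ϖ}) :
    IsLocalHom (algebraMap R (Localization.AtPrime P)) := by
  refine ⟨fun r hr => ?_⟩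
  by_contra hru
  have hrm : r ∈ maximalIdeal R := hru
  rw [hmax, Ideal.mem_span_singleton'] at hrm
  obtain ⟨c, rfl⟩ := hrm
  have hϖP : algebraMap R A ϖ ∈ P := hP.1.2 (Ideal.mem_span_singleton_self _)
  have hmem : algebraMap R (Localization.AtPrime P) (c * ϖ) ∈ maximalIdeal (Localization.AtPrime P) := by
    rw [map_mul, IsScalarTower.algebraMap_apply R A (Localization.AtPrime P) ϖ,
      ← Localization.AtPrime.map_eq_maximalIdeal]
    exact Ideal.mul_mem_left _ _ (Ideal.mem_map_of_mem _ hϖP)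
  exact hmem hr

include hϖ hP in
/-- The maximal ideal of `A_P` is the extension of the maximal ideal of `R` (both are generated by
`ϖ`, `maximalIdeal_localization_eq_span`). [folklore] -/
theorem map_maximalIdeal_localization :
    (maximalIdeal R).map (algebraMap R (Localization.AtPrime P)) =
      maximalIdeal (Localization.AtPrime P) := by
  rw [hϖ.maximalIdeal_eq, Ideal.map_span, Set.image_singleton,
    maximalIdeal_localization_eq_span hϖ P hP]

/-- **`κ(P)/k` is separable**: for a smooth `R`-algebra `A` over a discrete valuation ring `R` with
uniformizer `ϖ`, residue field `k = R/𝔪`, and a minimal prime `P` of `ϖA` (in fact any prime), the `k`-algebra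
`A_P/𝔪A_P` — which is the residue field `κ(P)` of `A_P` (`map_maximalIdeal_localization`) — is
formally smooth over `k`: it is the base change `k ⊗_R A_P` of the formally smooth `R`-algebra `A_P`.
[folklore] -/
theorem formallySmooth_residue_quotient :
    Algebra.FormallySmooth (R ⧸ maximalIdeal R)
      (Localization.AtPrime P ⧸ (maximalIdeal R).map (algebraMap R (Localization.AtPrime P))) := by
  haveI : Algebra.FormallySmooth A (Localization.AtPrime P) :=
    Algebra.FormallySmooth.of_isLocalization P.primeCompl
  haveI : Algebra.FormallySmooth R (Localization.AtPrime P) :=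
    Algebra.FormallySmooth.comp R A (Localization.AtPrime P)
  exact Algebra.FormallySmooth.of_equiv
    (Algebra.TensorProduct.quotIdealMapEquivQuotTensor (Localization.AtPrime P) (maximalIdeal R)).symm

include hϖ hP in
/-- The same for the residue field `κ(P)` of `A_P` itself, as a ring isomorphic over `k` to
`A_P/𝔪A_P`: the map of residue fields `k → κ(P)` induced by the local homomorphism `R → A_P`
is formally smooth. [folklore] -/
theorem formallySmooth_residueFieldMap :
    haveI := isLocalHom_algebraMap_localization P hP hϖ.maximalIdeal_eq
    (ResidueField.map (algebraMap R (Localization.AtPrime P))).FormallySmooth := by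
  haveI hloc := isLocalHom_algebraMap_localization P hP hϖ.maximalIdeal_eq
  have hsm := formallySmooth_residue_quotient (R := R) P
  have hmap := map_maximalIdeal_localization hϖ P hP
  -- `RingHom.FormallySmooth` of the composite `k → A_P/𝔪A_P ≅ κ(P)`
  have h1 : (algebraMap (R ⧸ maximalIdeal R) (Localization.AtPrime P ⧸
      (maximalIdeal R).map (algebraMap R (Localization.AtPrime P)))).FormallySmooth :=
    RingHom.formallySmooth_algebraMap.mpr hsm
  have h3 : ((Ideal.quotEquivOfEq hmap).toRingHom.comp (algebraMap (R ⧸ maximalIdeal R)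
      (Localization.AtPrime P ⧸ (maximalIdeal R).map (algebraMap R (Localization.AtPrime P))))).FormallySmooth :=
    RingHom.FormallySmooth.respectsIso.left _ (Ideal.quotEquivOfEq hmap) h1
  have heq : (ResidueField.map (algebraMap R (Localization.AtPrime P)) :
      ResidueField R →+* ResidueField (Localization.AtPrime P)) =
      (Ideal.quotEquivOfEq hmap).toRingHom.comp (algebraMap (R ⧸ maximalIdeal R)
        (Localization.AtPrime P ⧸ (maximalIdeal R).map (algebraMap R (Localization.AtPrime P)))) := by
    refine Ideal.Quotient.ringHom_ext (I := maximalIdeal R) (RingHom.ext fun r => ?_)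
    change ResidueField.map (algebraMap R (Localization.AtPrime P)) (residue R r) =
      Ideal.quotEquivOfEq hmap (Ideal.Quotient.mk
        ((maximalIdeal R).map (algebraMap R (Localization.AtPrime P))) (algebraMap R (Localization.AtPrime P) r))
    rw [Ideal.quotEquivOfEq_mk, ResidueField.map_residue]
    rfl
  rw [heq]
  exact h3

end Literature.AlgebraicGeometry.Smoothening

end
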